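import Summits.ValiantsHypothesis.ValiantsHypothesis.Theorems.LacunarySymmetroidMatrixDescartesCensusTwoRowElbowSix

/-!
# `MatrixDescartes` census — W4: elbow 5 in the kernel, I — quotient Rolle, the SHARP residual test, edge `ZP(5..17)`

HONEST FRAMING.  Object-search cell `pub-symmetroid`, item `DoorA26 = PosRootLawAt 2 6 19` (stmt-ValiantsHypothesis-19979,
OPEN, typed, never asserted).  The W4 line (engine-1 g17–g22: notes TROPFAN-W4-E1G17, CAPACITY09-E1G18, TWOROW-E1G19,
W4-E1G20/21, O9-E1G22) studies the DEGENERATIONS of HYPOTHETICAL Descartes-sharp symmetric `2 × 2` six-term pencils on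
the supports of chamber 1706 (pair-sum order of `(0,2,3,7,16,27)`).  A degeneration «through elbow 5» needs the hull-edge
form (EDGE GRAM LEMMA, zero-pattern pencil) of one of the long edges `5..y`, `y ∈ {17,18,19,20}`, to be Descartes-sharp
WITH MULTIPLICITY (`#terms − 1` positive roots).  For `y = 17` the form is
`F₁₇ = (a₀ + a₁X^{d₁} + a₂X^{d₂})(c₃X^{d₃} + c₄X^{d₄} + c₅X^{d₅}) − (b₂X^{d₂} + b₃X^{d₃} + b₄X^{d₄})²` (13 terms; 12 needed).
Seat note TWOROW-E1G19 §2 killed the four elbow-5 edges SUPPORT BY SUPPORT on the 115 core supports (115/114/114/113)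
with exact rational certificates, and W4-E1G21 (S1) showed that NO union of two-row certificates is chamber-uniform on an
elbow-5 edge — so, unlike THEOREM O6 (`…CensusTwoRowElbowSix`, chamber-uniform), elbow 5 enters the kernel as GENERIC
theorems with explicit numeric side conditions (this file: `5..17`; `…TwoRowEdge518/519/520`: the other three) plus
one ROW per support (`…TwoRowElbowFiveRows*`), each row discharging the side conditions by `norm_num`.

THE SHARP RESIDUAL TEST.  The two-row kill keeps rows `a₀, a₁` against two columns `c_j, c_k` and kills every other
exponent by Euler twists (`countP_posRoots_le_countP_twists`); the residual tetranomial
`A X^{n₀} + B X^{n₀+g} + C₀ X^{n₀+δ} + D X^{n₀+g+δ}` (`A, B > 0 > C₀, D` once the integer multipliers are in) has at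
most ONE positive root with multiplicity as soon as `h(u) = u^{−δ}(A + Bu^g)/(−C₀ − Du^g)` is strictly decreasing.  The
tree's `countP_posRoots_tetranomial_le_one` uses the sufficient monotone-ratio condition `B·(−C₀) ≤ A·(−D)`; here
(`countP_posRoots_tetranomial_le_one_of_disc`) the EXACT condition is used: with `m = (δ+g)·A·(−D) + (δ−g)·B·(−C₀)`,
`m ≥ 0 ∨ m² < 4δ²·A·B·(−C₀)·(−D)` — proved by a QUOTIENT ROLLE step with multiplicity
(`countP_posRoots_le_wronskian_add_one`: `#Z₊^{mult}(f) ≤ #Z₊^{mult}(g f′ − f g′) + 1` when `g` has no positive zero)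
for the divisor `g = X^δ(−C₀ − DX^g)`, whose Wronskian is `−X^{δ−1}·(δA(−C₀) + mX^g + δB(−D)X^{2g})`, zero-free on `(0,∞)`.
In the free coefficients the test reads `m_d ≥ 0 ∨ m_d² < 4δ²(M₀M₃)(M₁M₂)` with `m_d = (δ+g)M₀M₃ + (δ−g)M₁M₂` on the
four integer multipliers alone (the common factor `−a₀a₁c_jc_k > 0` drops out), `δ = d₁`, `g = d_k − d_j`.
Seat datum (engine-1 g23, exact, independent re-implementation `cover.py`): on the 115 core supports the monotone
condition certifies only 113 / 106 / 103 / 102 supports for `5..17 / 5..18 / 5..19 / 5..20`, the sharp one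
115 / 114 / 114 / 113 — every pair the seat table kills (columns `(c₃,c₅)` alone on `5..17`; `(c₃,c₄)` or `(c₄,c₅)` on
the others); the misses are the four two-row-resistant pairs of TWOROW-E1G19 §4 (engine-2 g24/g25 hull certificates,
cell level).  Nothing in this file bounds `ζ_sym(2,6)`, decides `DoorA26`, or bears on the crux `MatrixDescartes`
(stmt-ValiantsHypothesis-18050) / `VP ≠ VNP`: a dead channel is a statement about hypothetical objects.

[folklore] Rolle with multiplicity (Euler twists, quotient Rolle) + a discriminant; no single source.
-/

-- `Summit.ValiantsHypothesis.ValiantsHypothesis.…` repeats a component by the D-0017 layout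
-- (single-conjunct summit), which the `dupNamespace` linter flags; the name is mandated.
set_option linter.dupNamespace false

namespace Summit.ValiantsHypothesis.ValiantsHypothesis.Theorems.LacunarySymmetroidMatrixDescartes.Census

open Polynomial Finset
open scoped BigOperators Polynomial

/-! ### Quotient Rolle (Wronskian form), with multiplicity -/

/-- A root of multiplicity `m` of `f` is a root of multiplicity at least `m − 1` of the Wronskian `W = g·f′ − f·g′`.
[folklore] -/
theorem rootMultiplicity_le_wronskian_succ (f g W : ℝ[X]) (x : ℝ)
    (hWdef : W = g * derivative f - f * derivative g) (hW : W ≠ 0) :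
    f.rootMultiplicity x ≤ W.rootMultiplicity x + 1 := by
  have h1 : (X - C x) ^ (f.rootMultiplicity x - 1) ∣ derivative f := by
    rcases eq_or_ne (derivative f) 0 with hd | hd
    · rw [hd]; exact dvd_zero _
    · exact (le_rootMultiplicity_iff hd).mp (rootMultiplicity_sub_one_le_derivative_rootMultiplicity _ x)
  have h2 : (X - C x) ^ (f.rootMultiplicity x - 1) ∣ f :=
    (pow_dvd_pow _ (Nat.sub_le _ _)).trans (pow_rootMultiplicity_dvd _ x)
  have h3 : (X - C x) ^ (f.rootMultiplicity x - 1) ∣ W := by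
    rw [hWdef]
    exact dvd_sub (dvd_mul_of_dvd_right h1 _) (dvd_mul_of_dvd_left h2 _)
  have := (le_rootMultiplicity_iff hW).mpr h3
  omega

/-- **QUOTIENT ROLLE, with multiplicity.**  Let `f, g` be real polynomials, `g` without positive zeros, and
`W = g·f′ − f·g′ ≠ 0`.  Then `#Z₊^{mult}(f) ≤ #Z₊^{mult}(W) + 1`: strictly between consecutive positive zeros of `f`
the quotient `f/g` has a critical point (Rolle), i.e. a zero of `W` that is not a zero of `f`, and a zero of `f` of
multiplicity `m` is a zero of `W` of multiplicity `≥ m − 1`. [folklore] -/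
theorem countP_posRoots_le_wronskian_add_one (f g W : ℝ[X]) (hWdef : W = g * derivative f - f * derivative g)
    (hW : W ≠ 0) (hg : ∀ x : ℝ, 0 < x → g.eval x ≠ 0) :
    f.roots.countP (fun x => 0 < x) ≤ W.roots.countP (fun x => 0 < x) + 1 := by
  classical
  have hf : f ≠ 0 := by
    rintro rfl
    apply hW
    rw [hWdef]; simp
  have hmult : ∀ x ∈ f.roots.toFinset.filter (fun x => 0 < x),
      f.rootMultiplicity x ≤ W.rootMultiplicity x + 1 :=
    fun x _ => rootMultiplicity_le_wronskian_succ f g W x hWdef hW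
  have hinter : (f.roots.toFinset.filter (fun x => 0 < x)).card ≤
      ((W.roots.toFinset.filter (fun x => 0 < x)) \ (f.roots.toFinset.filter (fun x => 0 < x))).card + 1 := by
    refine Finset.card_le_sdiff_of_interleaved fun a ha b hb hab _ => ?_
    simp only [Finset.mem_filter, Multiset.mem_toFinset, mem_roots hf] at ha hb
    obtain ⟨hfa, ha0⟩ := ha
    obtain ⟨hfb, hb0⟩ := hb
    rw [IsRoot.def] at hfa hfb
    have hgne : ∀ u ∈ Set.Icc a b, g.eval u ≠ 0 := fun u hu => hg u (ha0.trans_le hu.1)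
    have hder : ∀ u ∈ Set.Ioo a b, HasDerivAt (fun u => f.eval u * (g.eval u)⁻¹)
        ((derivative f).eval u * (g.eval u)⁻¹ + f.eval u * (-((derivative g).eval u) / (g.eval u) ^ 2)) u := by
      intro u hu
      have hgu : g.eval u ≠ 0 := hgne u ⟨hu.1.le, hu.2.le⟩
      exact (f.hasDerivAt u).mul ((g.hasDerivAt u).inv hgu)
    have hcont : ContinuousOn (fun u => f.eval u * (g.eval u)⁻¹) (Set.Icc a b) :=
      f.continuousOn.mul (g.continuousOn.inv₀ hgne)
    obtain ⟨z, hz, hz0⟩ := exists_hasDerivAt_eq_zero hab hcont (by simp [hfa, hfb]) hder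
    have hgz : g.eval z ≠ 0 := hgne z ⟨hz.1.le, hz.2.le⟩
    refine ⟨z, ?_, hz.1, hz.2⟩
    simp only [Finset.mem_filter, Multiset.mem_toFinset, mem_roots hW, IsRoot.def]
    refine ⟨?_, ha0.trans hz.1⟩
    have e : ((derivative f).eval z * (g.eval z)⁻¹ + f.eval z * (-((derivative g).eval z) / (g.eval z) ^ 2))
        * (g.eval z) ^ 2 = g.eval z * (derivative f).eval z - f.eval z * (derivative g).eval z := by
      field_simp
      ring
    rw [hz0, zero_mul] at e
    rw [hWdef, eval_sub, eval_mul, eval_mul]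
    exact e.symm
  have main := countP_posRoots_add_le_of_interleaved f W hW 0 hmult (by rw [add_zero]; exact hinter)
  rw [add_zero] at main
  exact main

/-! ### The residual tetranomial: sharp monotonicity test -/

/-- **The residual tetranomial has at most one positive root, counted with multiplicity — sharp test.**  For reals
`A, B > 0 > C₀, D`, exponents `n₁ = n₀ + g`, `n₂ = n₀ + δ`, `n₃ = n₀ + g + δ` (`δ ≥ 1`; `g = 0` is allowed and trivial) and
`m = (δ+g)·A·(−D) + (δ−g)·B·(−C₀)` with `m ≥ 0 ∨ m² < 4δ²·(A·(−D))·(B·(−C₀))`: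
`#Z₊^{mult}(A X^{n₀} + B X^{n₁} + C₀ X^{n₂} + D X^{n₃}) ≤ 1`.  (Quotient Rolle for the divisor `X^δ(−C₀ − D X^g)`: the
Wronskian is `−X^{δ−1}(δA(−C₀) + m X^g + δB(−D) X^{2g})`, which has no positive zero.) [folklore] -/
theorem countP_posRoots_tetranomial_le_one_of_disc (A B C₀ D : ℝ) (hA : 0 < A) (hB : 0 < B) (hC : C₀ < 0)
    (hD : D < 0) {n₀ n₁ n₂ n₃ g δ : ℕ} (hδ : 0 < δ)
    (h₁ : n₁ = n₀ + g) (h₂ : n₂ = n₀ + δ) (h₃ : n₃ = n₀ + g + δ)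
    (hdisc : 0 ≤ ((δ : ℝ) + g) * (A * -D) + ((δ : ℝ) - g) * (B * -C₀) ∨
      (((δ : ℝ) + g) * (A * -D) + ((δ : ℝ) - g) * (B * -C₀)) ^ 2 < 4 * (δ : ℝ) ^ 2 * (A * -D) * (B * -C₀)) :
    (C A * X ^ n₀ + C B * X ^ n₁ + C C₀ * X ^ n₂ + C D * X ^ n₃ : ℝ[X]).roots.countP (fun x => 0 < x) ≤ 1 := by
  classical
  subst h₁ h₂ h₃
  set Q : ℝ[X] := C A + C B * X ^ g + C C₀ * X ^ δ + C D * X ^ (g + δ) with hQ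
  have hfac : (C A * X ^ n₀ + C B * X ^ (n₀ + g) + C C₀ * X ^ (n₀ + δ) + C D * X ^ (n₀ + g + δ) : ℝ[X])
      = X ^ n₀ * Q := by rw [hQ]; ring
  rw [hfac, countP_posRoots_X_pow_mul]
  -- the divisor `G = X^δ (−C₀ − D X^g)` and the Wronskian `W = G Q′ − Q G′`
  set G : ℝ[X] := C (-C₀) * X ^ δ + C (-D) * X ^ (g + δ) with hG
  set W : ℝ[X] := G * derivative Q - Q * derivative G with hWdef
  set m : ℝ := ((δ : ℝ) + g) * (A * -D) + ((δ : ℝ) - g) * (B * -C₀) with hm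
  -- `X · W = −X^δ · N`, `N = δA(−C₀) + m X^g + δB(−D) X^{2g}`
  have eg := Literature.Analysis.FluidPDE.Elgindi.X_mul_derivative_X_pow g
  have ed := Literature.Analysis.FluidPDE.Elgindi.X_mul_derivative_X_pow δ
  have egd := Literature.Analysis.FluidPDE.Elgindi.X_mul_derivative_X_pow (g + δ)
  have hXQ : X * derivative Q = C (B * g) * X ^ g + C (C₀ * δ) * X ^ δ + C (D * ((g : ℝ) + δ)) * X ^ (g + δ) := by
    have hlin : X * derivative Q = C B * (X * derivative (X ^ g)) + C C₀ * (X * derivative (X ^ δ))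
        + C D * (X * derivative (X ^ (g + δ))) := by
      simp only [hQ, derivative_add, derivative_C_mul, derivative_C, zero_add]; ring
    rw [hlin, eg, ed, egd]
    simp only [map_mul, map_add, Nat.cast_add]; ring
  have hXG : X * derivative G = C (-C₀ * δ) * X ^ δ + C (-D * ((g : ℝ) + δ)) * X ^ (g + δ) := by
    have hlin : X * derivative G = C (-C₀) * (X * derivative (X ^ δ)) + C (-D) * (X * derivative (X ^ (g + δ))) := by
      simp only [hG, derivative_add, derivative_C_mul]; ring
    rw [hlin, ed, egd]
    simp only [map_mul, map_add, map_neg, Nat.cast_add]; ring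
  have hXW : X * W = -(X ^ δ * (C (δ * (A * -C₀)) + C m * X ^ g + C (δ * (B * -D)) * X ^ (2 * g))) := by
    have e1 : X * W = G * (X * derivative Q) - Q * (X * derivative G) := by rw [hWdef]; ring
    rw [e1, hXQ, hXG, hG, hQ, hm]
    simp only [map_mul, map_add, map_neg, map_sub, map_natCast, pow_add, two_mul]
    ring
  -- `N > 0` on `(0, ∞)`
  have hNpos : ∀ x : ℝ, 0 < x → 0 < δ * (A * -C₀) + m * x ^ g + δ * (B * -D) * x ^ (2 * g) := by
    intro x hx
    have hu : 0 < x ^ g := pow_pos hx g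
    have hAC : 0 < A * -C₀ := mul_pos hA (neg_pos.2 hC)
    have hBD : 0 < B * -D := mul_pos hB (neg_pos.2 hD)
    have hAD : 0 < A * -D := mul_pos hA (neg_pos.2 hD)
    have hBC : 0 < B * -C₀ := mul_pos hB (neg_pos.2 hC)
    have hδ' : (0 : ℝ) < δ := by exact_mod_cast hδ
    rw [pow_mul', sq] at *
    rcases hdisc with hm0 | hsq
    · have : 0 ≤ m * x ^ g := mul_nonneg hm0 hu.le
      nlinarith [mul_pos (mul_pos hδ' hAC) one_pos, mul_pos (mul_pos hδ' hBD) (mul_pos hu hu)]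
    · -- 4 δ B(−D) · N = (2 δ B (−D) u + m)² + (4 δ² (A·−D)(B·−C₀) − m²)
      have iden : 4 * (δ * (B * -D)) * (δ * (A * -C₀) + m * x ^ g + δ * (B * -D) * (x ^ g * x ^ g))
          = (2 * (δ * (B * -D)) * x ^ g + m) ^ 2 + (4 * (δ * δ) * (A * -D) * (B * -C₀) - m ^ 2) := by ring
      have h4 : 0 < 4 * (δ * (B * -D)) := by positivity
      have hrhs : 0 < (2 * (δ * (B * -D)) * x ^ g + m) ^ 2 + (4 * (δ * δ) * (A * -D) * (B * -C₀) - m ^ 2) := by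
        nlinarith [sq_nonneg (2 * (δ * (B * -D)) * x ^ g + m)]
      rw [← iden] at hrhs
      exact pos_of_mul_pos_right hrhs h4.le
  -- hence `W` has no positive zero
  have hWeval : ∀ x : ℝ, 0 < x → W.eval x ≠ 0 := by
    intro x hx hWx
    have e := congr_arg (fun p : ℝ[X] => p.eval x) hXW
    simp only [eval_mul, eval_X, eval_neg, eval_add, eval_C, eval_pow] at e
    rw [hWx, mul_zero] at e
    have hx' : 0 < x ^ δ := pow_pos hx δ
    have := hNpos x hx
    nlinarith [mul_pos hx' this]
  have hW0 : W ≠ 0 := by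
    intro h
    exact hWeval 1 one_pos (by rw [h, eval_zero])
  have hWcount : W.roots.countP (fun x => 0 < x) = 0 := by
    refine Multiset.countP_eq_zero.mpr fun x hx hpos => ?_
    exact hWeval x hpos ((mem_roots hW0).mp hx)
  -- the divisor has no positive zero
  have hGeval : ∀ x : ℝ, 0 < x → G.eval x ≠ 0 := by
    intro x hx
    have : G.eval x = -C₀ * x ^ δ + -D * x ^ (g + δ) := by
      simp only [hG, eval_add, eval_mul, eval_C, eval_pow, eval_X]
    rw [this]
    have h1 : 0 < -C₀ * x ^ δ := mul_pos (neg_pos.2 hC) (pow_pos hx δ)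
    have h2 : 0 < -D * x ^ (g + δ) := mul_pos (neg_pos.2 hD) (pow_pos hx _)
    linarith
  have main := countP_posRoots_le_wronskian_add_one Q G W hWdef hW0 hGeval
  omega

/-- Sharp residual test, mirrored signs (`A, B < 0 < C₀, D`; `m = (δ+g)·(−A)·D + (δ−g)·(−B)·C₀`). [folklore] -/
theorem countP_posRoots_tetranomial_le_one_of_disc' (A B C₀ D : ℝ) (hA : A < 0) (hB : B < 0) (hC : 0 < C₀)
    (hD : 0 < D) {n₀ n₁ n₂ n₃ g δ : ℕ} (hδ : 0 < δ)
    (h₁ : n₁ = n₀ + g) (h₂ : n₂ = n₀ + δ) (h₃ : n₃ = n₀ + g + δ)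
    (hdisc : 0 ≤ ((δ : ℝ) + g) * (-A * D) + ((δ : ℝ) - g) * (-B * C₀) ∨
      (((δ : ℝ) + g) * (-A * D) + ((δ : ℝ) - g) * (-B * C₀)) ^ 2 < 4 * (δ : ℝ) ^ 2 * (-A * D) * (-B * C₀)) :
    (C A * X ^ n₀ + C B * X ^ n₁ + C C₀ * X ^ n₂ + C D * X ^ n₃ : ℝ[X]).roots.countP (fun x => 0 < x) ≤ 1 := by
  rw [← countP_posRoots_neg]
  have e : -(C A * X ^ n₀ + C B * X ^ n₁ + C C₀ * X ^ n₂ + C D * X ^ n₃ : ℝ[X])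
      = C (-A) * X ^ n₀ + C (-B) * X ^ n₁ + C (-C₀) * X ^ n₂ + C (-D) * X ^ n₃ := by
    simp only [map_neg]; ring
  rw [e]
  refine countP_posRoots_tetranomial_le_one_of_disc (-A) (-B) (-C₀) (-D) (neg_pos.2 hA) (neg_pos.2 hB)
    (neg_lt_zero.2 hC) (neg_lt_zero.2 hD) hδ h₁ h₂ h₃ ?_
  simp only [neg_neg]
  exact hdisc


/-! ### Chamber 1706, edge `5..17`: the generic two-row theorem (columns `c₃, c₅`) -/

/-- **Edge `5..17` (chamber 1706), rows `(a₀,a₁)` × columns `(c₃,c₅)` — generic two-row kill, sharp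
residual test.**
For natural exponents `d₁,…,d₅` and the four integer multipliers `M₀..M₃` of the kept terms
`a₀c₃X^{d₃}, a₀c₅X^{d₅}, a₁c₃X^{d₁+d₃}, a₁c₅X^{d₁+d₅}` (products over the 9 killed exponents,
given as explicit hypotheses so that a numeric row discharges them by `norm_num`), all positive, with the
cell's signs on the kept terms and the sharp certificate `m ≥ 0 ∨ m² < 4δ²·(M₀M₃)(M₁M₂)` (`δ = d₁`, `g = d₅ − d₃`,
`m = (δ+g)M₀M₃ + (δ−g)M₁M₂`): the 13-term edge form has at most `10 < 12 = #terms − 1` positive roots counted with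
multiplicity. [folklore] -/
theorem countP_posRoots_zp_5_17_le_of_cert35 (d₁ d₂ d₃ d₄ d₅ : ℕ) (M₀ M₁ M₂ M₃ : ℝ)
    (hM₀ : M₀ = ((d₃ : ℝ) - ((2 * d₂ : ℕ) : ℝ)) * ((d₃ : ℝ) - ((d₂ + d₃ : ℕ) : ℝ)) *
        ((d₃ : ℝ) - ((2 * d₃ : ℕ) : ℝ)) * ((d₃ : ℝ) - (d₄ : ℝ)) * ((d₃ : ℝ) - ((d₁ + d₄ : ℕ) : ℝ)) *
        ((d₃ : ℝ) - ((d₂ + d₄ : ℕ) : ℝ)) * ((d₃ : ℝ) - ((d₃ + d₄ : ℕ) : ℝ)) * ((d₃ : ℝ) - ((d₂ + d₅ : ℕ) : ℝ)) *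
        ((d₃ : ℝ) - ((2 * d₄ : ℕ) : ℝ)))
    (hM₁ : M₁ = ((d₅ : ℝ) - ((2 * d₂ : ℕ) : ℝ)) * ((d₅ : ℝ) - ((d₂ + d₃ : ℕ) : ℝ)) *
        ((d₅ : ℝ) - ((2 * d₃ : ℕ) : ℝ)) * ((d₅ : ℝ) - (d₄ : ℝ)) * ((d₅ : ℝ) - ((d₁ + d₄ : ℕ) : ℝ)) *
        ((d₅ : ℝ) - ((d₂ + d₄ : ℕ) : ℝ)) * ((d₅ : ℝ) - ((d₃ + d₄ : ℕ) : ℝ)) * ((d₅ : ℝ) - ((d₂ + d₅ : ℕ) : ℝ)) *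
        ((d₅ : ℝ) - ((2 * d₄ : ℕ) : ℝ)))
    (hM₂ : M₂ = (((d₁ + d₃ : ℕ) : ℝ) - ((2 * d₂ : ℕ) : ℝ)) * (((d₁ + d₃ : ℕ) : ℝ) - ((d₂ + d₃ : ℕ) : ℝ)) *
        (((d₁ + d₃ : ℕ) : ℝ) - ((2 * d₃ : ℕ) : ℝ)) * (((d₁ + d₃ : ℕ) : ℝ) - (d₄ : ℝ)) *
        (((d₁ + d₃ : ℕ) : ℝ) - ((d₁ + d₄ : ℕ) : ℝ)) * (((d₁ + d₃ : ℕ) : ℝ) - ((d₂ + d₄ : ℕ) : ℝ)) *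
        (((d₁ + d₃ : ℕ) : ℝ) - ((d₃ + d₄ : ℕ) : ℝ)) * (((d₁ + d₃ : ℕ) : ℝ) - ((d₂ + d₅ : ℕ) : ℝ)) *
        (((d₁ + d₃ : ℕ) : ℝ) - ((2 * d₄ : ℕ) : ℝ)))
    (hM₃ : M₃ = (((d₁ + d₅ : ℕ) : ℝ) - ((2 * d₂ : ℕ) : ℝ)) * (((d₁ + d₅ : ℕ) : ℝ) - ((d₂ + d₃ : ℕ) : ℝ)) *
        (((d₁ + d₅ : ℕ) : ℝ) - ((2 * d₃ : ℕ) : ℝ)) * (((d₁ + d₅ : ℕ) : ℝ) - (d₄ : ℝ)) *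
        (((d₁ + d₅ : ℕ) : ℝ) - ((d₁ + d₄ : ℕ) : ℝ)) * (((d₁ + d₅ : ℕ) : ℝ) - ((d₂ + d₄ : ℕ) : ℝ)) *
        (((d₁ + d₅ : ℕ) : ℝ) - ((d₃ + d₄ : ℕ) : ℝ)) * (((d₁ + d₅ : ℕ) : ℝ) - ((d₂ + d₅ : ℕ) : ℝ)) *
        (((d₁ + d₅ : ℕ) : ℝ) - ((2 * d₄ : ℕ) : ℝ)))
    (hd₁ : 0 < d₁) (hjk : d₃ < d₅) (h₀ : 0 < M₀) (h₁ : 0 < M₁) (h₂ : 0 < M₂) (h₃ : 0 < M₃)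
    (hcert : 0 ≤ ((d₁ : ℝ) + ((d₅ : ℝ) - (d₃ : ℝ))) * (M₀ * M₃) + ((d₁ : ℝ) - ((d₅ : ℝ) - (d₃ : ℝ))) * (M₁ * M₂) ∨
      (((d₁ : ℝ) + ((d₅ : ℝ) - (d₃ : ℝ))) * (M₀ * M₃) + ((d₁ : ℝ) - ((d₅ : ℝ) - (d₃ : ℝ))) * (M₁ * M₂)) ^ 2
        < 4 * (d₁ : ℝ) ^ 2 * (M₀ * M₃) * (M₁ * M₂))
    (a₀ a₁ a₂ c₃ c₄ c₅ b₂ b₃ b₄ : ℝ) (s₀₃ : 0 < a₀ * c₃) (s₀₅ : 0 < a₀ * c₅) (s₁₃ : a₁ * c₃ < 0)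
    (s₁₅ : a₁ * c₅ < 0) :
    (((C a₀ + C a₁ * X ^ d₁ + C a₂ * X ^ d₂)
          * (C c₃ * X ^ d₃ + C c₄ * X ^ d₄ + C c₅ * X ^ d₅)
        - (C b₂ * X ^ d₂ + C b₃ * X ^ d₃ + C b₄ * X ^ d₄) ^ 2 : ℝ[X]).roots.countP
      (fun x => 0 < x)) ≤ 10 := by
  classical
  set e : ℕ → ℕ := fun t => match t with
    | 0 => d₃ | 1 => d₅ | 2 => d₁ + d₃ | 3 => d₁ + d₅ | 4 => 2 * d₂ | 5 => d₂ + d₃ | 6 => 2 * d₃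
    | 7 => d₄ | 8 => d₁ + d₄ | 9 => d₂ + d₄ | 10 => d₃ + d₄ | 11 => d₂ + d₅ | 12 => 2 * d₄ | _ => 0 with he
  set c : ℕ → ℝ := fun t => match t with
    | 0 => a₀ * c₃ | 1 => a₀ * c₅ | 2 => a₁ * c₃ | 3 => a₁ * c₅ | 4 => -(b₂ ^ 2)
    | 5 => a₂ * c₃ - (b₂ * b₃ + b₂ * b₃) | 6 => -(b₃ ^ 2) | 7 => a₀ * c₄ | 8 => a₁ * c₄
    | 9 => a₂ * c₄ - (b₂ * b₄ + b₂ * b₄) | 10 => -((b₃ * b₄ + b₃ * b₄)) | 11 => a₂ * c₅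
    | 12 => -(b₄ ^ 2) | _ => 0 with hc
  have hF : ((C a₀ + C a₁ * X ^ d₁ + C a₂ * X ^ d₂)
          * (C c₃ * X ^ d₃ + C c₄ * X ^ d₄ + C c₅ * X ^ d₅)
        - (C b₂ * X ^ d₂ + C b₃ * X ^ d₃ + C b₄ * X ^ d₄) ^ 2 : ℝ[X])
      = ∑ t ∈ range 13, C (c t) * X ^ (e t) := by
    simp only [Finset.sum_range_succ, Finset.sum_range_zero, zero_add, he, hc, map_mul, map_neg,
      map_pow, map_add, map_sub, pow_add, two_mul]
    ring
  rw [hF]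
  clear hF
  have step := countP_posRoots_le_countP_twists 13 e c (Ico 4 13)
  have hcard : (Ico 4 13).card = 9 := by simp
  rw [hcard] at step
  obtain ⟨M, hM⟩ : ∃ M : ℕ → ℝ, ∀ t, M t = ∏ u ∈ Ico 4 13, ((e t : ℝ) - e u) := ⟨_, fun _ => rfl⟩
  have hres : (∑ t ∈ range 13, C (c t * ∏ u ∈ Ico 4 13, ((e t : ℝ) - e u)) * X ^ (e t) : ℝ[X])
      = C (c 0 * M 0) * X ^ (e 0) + C (c 1 * M 1) * X ^ (e 1) + C (c 2 * M 2) * X ^ (e 2)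
        + C (c 3 * M 3) * X ^ (e 3) := by
    rw [Finset.range_eq_Ico, ← Finset.sum_Ico_consecutive _ (show 0 ≤ 4 by norm_num) (show 4 ≤ 13 by norm_num)]
    have hz : (∑ t ∈ Ico 4 13, C (c t * ∏ u ∈ Ico 4 13, ((e t : ℝ) - e u)) * X ^ (e t) : ℝ[X]) = 0 := by
      refine Finset.sum_eq_zero fun t ht => ?_
      rw [Finset.prod_eq_zero ht (sub_self _), mul_zero, map_zero, zero_mul]
    rw [hz, add_zero, Nat.Ico_zero_eq_range]
    simp only [Finset.sum_range_succ, Finset.sum_range_zero, zero_add, ← hM]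
  rw [hres] at step
  clear hres
  have e0 : e 0 = d₃ := rfl
  have e1 : e 1 = d₅ := rfl
  have e2 : e 2 = d₁ + d₃ := rfl
  have e3 : e 3 = d₁ + d₅ := rfl
  have c0 : c 0 = a₀ * c₃ := rfl
  have c1 : c 1 = a₀ * c₅ := rfl
  have c2 : c 2 = a₁ * c₃ := rfl
  have c3 : c 3 = a₁ * c₅ := rfl
  rw [e0, e1, e2, e3, c0, c1, c2, c3] at step
  have unroll : ∀ t, M t = ((e t : ℝ) - e 4) * ((e t : ℝ) - e 5) * ((e t : ℝ) - e 6) * ((e t : ℝ) - e 7) *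
      ((e t : ℝ) - e 8) * ((e t : ℝ) - e 9) * ((e t : ℝ) - e 10) * ((e t : ℝ) - e 11) * ((e t : ℝ) - e 12) := by
    intro t
    rw [hM, Finset.prod_Ico_eq_prod_range]
    simp only [show (13 : ℕ) - 4 = 9 by norm_num, Finset.prod_range_succ, Finset.prod_range_zero, one_mul,
      Nat.reduceAdd]
  have e4 : e 4 = 2 * d₂ := rfl
  have e5 : e 5 = d₂ + d₃ := rfl
  have e6 : e 6 = 2 * d₃ := rfl
  have e7 : e 7 = d₄ := rfl
  have e8 : e 8 = d₁ + d₄ := rfl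
  have e9 : e 9 = d₂ + d₄ := rfl
  have e10 : e 10 = d₃ + d₄ := rfl
  have e11 : e 11 = d₂ + d₅ := rfl
  have e12 : e 12 = 2 * d₄ := rfl
  have hM0' : M 0 = M₀ := by
    rw [hM₀, unroll, e0, e4, e5, e6, e7, e8, e9, e10, e11, e12]
  have hM1' : M 1 = M₁ := by
    rw [hM₁, unroll, e1, e4, e5, e6, e7, e8, e9, e10, e11, e12]
  have hM2' : M 2 = M₂ := by
    rw [hM₂, unroll, e2, e4, e5, e6, e7, e8, e9, e10, e11, e12]
  have hM3' : M 3 = M₃ := by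
    rw [hM₃, unroll, e3, e4, e5, e6, e7, e8, e9, e10, e11, e12]
  have hA : 0 < a₀ * c₃ * M 0 := by rw [hM0']; exact mul_pos s₀₃ h₀
  have hB : 0 < a₀ * c₅ * M 1 := by rw [hM1']; exact mul_pos s₀₅ h₁
  have hC : a₁ * c₃ * M 2 < 0 := by rw [hM2']; exact mul_neg_of_neg_of_pos s₁₃ h₂
  have hD : a₁ * c₅ * M 3 < 0 := by rw [hM3']; exact mul_neg_of_neg_of_pos s₁₅ h₃
  have hκ : 0 < a₀ * c₅ * -(a₁ * c₃) := mul_pos s₀₅ (neg_pos.2 s₁₃)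
  have hg : (((d₅ - d₃ : ℕ) : ℝ)) = (d₅ : ℝ) - (d₃ : ℝ) := by push_cast [hjk.le]; ring
  have iAD : (a₀ * c₃ * M 0 * -(a₁ * c₅ * M 3)) = (a₀ * c₅ * -(a₁ * c₃)) * (M₀ * M₃) := by
    rw [hM0', hM3']; ring
  have iBC : (a₀ * c₅ * M 1 * -(a₁ * c₃ * M 2)) = (a₀ * c₅ * -(a₁ * c₃)) * (M₁ * M₂) := by
    rw [hM1', hM2']; ring
  have hdisc : 0 ≤ ((d₁ : ℝ) + ((d₅ - d₃ : ℕ) : ℝ)) * (a₀ * c₃ * M 0 * -(a₁ * c₅ * M 3))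
        + ((d₁ : ℝ) - ((d₅ - d₃ : ℕ) : ℝ)) * (a₀ * c₅ * M 1 * -(a₁ * c₃ * M 2)) ∨
      (((d₁ : ℝ) + ((d₅ - d₃ : ℕ) : ℝ)) * (a₀ * c₃ * M 0 * -(a₁ * c₅ * M 3))
          + ((d₁ : ℝ) - ((d₅ - d₃ : ℕ) : ℝ)) * (a₀ * c₅ * M 1 * -(a₁ * c₃ * M 2))) ^ 2
        < 4 * (d₁ : ℝ) ^ 2 * (a₀ * c₃ * M 0 * -(a₁ * c₅ * M 3)) * (a₀ * c₅ * M 1 * -(a₁ * c₃ * M 2)) := by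
    rw [iAD, iBC, hg]
    set κ := a₀ * c₅ * -(a₁ * c₃) with hκdef
    set md := ((d₁ : ℝ) + ((d₅ : ℝ) - (d₃ : ℝ))) * (M₀ * M₃) + ((d₁ : ℝ) - ((d₅ : ℝ) - (d₃ : ℝ))) * (M₁ * M₂)
      with hmd
    have i1 : ((d₁ : ℝ) + ((d₅ : ℝ) - (d₃ : ℝ))) * (κ * (M₀ * M₃))
        + ((d₁ : ℝ) - ((d₅ : ℝ) - (d₃ : ℝ))) * (κ * (M₁ * M₂)) = κ * md := by
      rw [hmd]; ring
    have i2 : 4 * (d₁ : ℝ) ^ 2 * (κ * (M₀ * M₃)) * (κ * (M₁ * M₂))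
        = κ ^ 2 * (4 * (d₁ : ℝ) ^ 2 * (M₀ * M₃) * (M₁ * M₂)) := by
      ring
    rw [i1, i2]
    rcases hcert with h | h
    · exact Or.inl (mul_nonneg hκ.le h)
    · right
      rw [mul_pow]
      exact mul_lt_mul_of_pos_left h (pow_pos hκ 2)
  have tet : ((C (a₀ * c₃ * M 0) * X ^ d₃ + C (a₀ * c₅ * M 1) * X ^ d₅ + C (a₁ * c₃ * M 2) * X ^ (d₁ + d₃)
      + C (a₁ * c₅ * M 3) * X ^ (d₁ + d₅) : ℝ[X]).roots.countP (fun x => 0 < x)) ≤ 1 :=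
    countP_posRoots_tetranomial_le_one_of_disc _ _ _ _ hA hB hC hD (g := d₅ - d₃) (δ := d₁)
      hd₁ (Nat.add_sub_of_le hjk.le).symm (Nat.add_comm _ _)
      (by rw [Nat.add_sub_of_le hjk.le, Nat.add_comm]) hdisc
  exact (step.trans (Nat.add_le_add_right tet _)).trans (by norm_num)

end Summit.ValiantsHypothesis.ValiantsHypothesis.Theorems.LacunarySymmetroidMatrixDescartes.Census
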